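import Summits.BirchSwinnertonDyer.BirchSwinnertonDyer.Theorems.ByReductionTypeAtTwoSupersingularFlatBlindNoCotorsion
import Summits.BirchSwinnertonDyer.Rank1Residual.Iwasawa.NoFiniteSubmoduleQuotientRank
import Literature.NumberTheory.EllipticCurves.Sprung2012.SharpFlatSelmerDualRestrictionProofs
import Literature.NumberTheory.EllipticCurves.IwasawaSelmerModuleFiniteProofs
import Literature.NumberTheory.EllipticCurves.IwasawaSelmerDualProofs
import HarnessLib

/-!
# Route `ByReductionTypeAtTwo` (rung K4), crux `SupersingularRankZeroAtTwo` (item stmt-BirchSwinnertonDyer-19097), line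
# `odd_blind_package` (registry v2.11), slot 4 `stub_NFflat : FlatNoFiniteSubmoduleAtTwo` (NF♭):
# **NF♭ REDUCED IN THE KERNEL TO «CLASSICAL NF AT SUPERSINGULAR 2» + «THE KERNEL OF `X ↠ X♭` IS CYCLIC» + «`rank_Λ X ≥ 1`»
# — the Kitajima–Otsuki road (Tokyo J. Math. 41 (2018) §4.2: Prop. 4.6 + Prop. 4.7 ⟹ Thm. 4.8) at `p = 2` for Sprung's `♭`
# (cell `bsd-2adic`, LEAD ss-1 GEN 23; `--supports 19097`, helper)

HONEST FRAMING: THEOREMS ONLY (no definition, no named fact, no `sorry`, no instance).  Nothing here proves NF♭: the file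
DECOMPOSES the registered research stub 4 of the line into three displayed inputs and proves the composition.  19097 stays OPEN;
nothing is booked; BSD is proved for no curve by any of this.  bears_on: K4 (19097).

## The road (why it replaces «♭ global-to-local surjectivity over ℚ_∞» as the next hand)

B. D. Kim 2013 / Greenberg LNM 1716 Prop. 4.14–4.15 reach «`X^±` has no non-zero finite `Λ`-submodule» through the SURJECTIVITY of the
global-to-local map over `ℚ_∞` for the `±` condition at GENERIC twists (LEAD GEN 22 scoping memo `SCOPE-NF-FLAT-GEN22.md` §3 (ii)–(iv)).
Kitajima–Otsuki 2018 §4.2 reach the same conclusion WITHOUT any global-to-local surjectivity and without twisting: the Pontryagin dual of the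
DEFINITION `Sel^• = ker(Sel → H¹(k_∞, E[p^∞]) / E^•_∞)` is an exact sequence `(H¹(k_∞)/E^•_∞)^∨ →ι X ↠ X^• → 0` (always exact — Pontryagin
duality), `(H¹(k_∞)/E^•_∞)^∨ ≅ Λ^{[k:ℚ_p]}` is FREE (their Prop. 3.32: Greenberg's local lemma + the structure of the `•` condition), `ι` is
injective by a rank count (Prop. 4.6: `X^•` torsion and `rank_Λ X ≥ [k:ℚ_p]`, Greenberg Thm. 1.7), and Greenberg's lemma (pp. 104–105 =
their Prop. 4.7) transports «no finite submodule» from `X` to `X / ι(Λ^r) ≅ X^•`.  The classical input «`X(E/ℚ_∞)` has no non-zero finite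
`Λ`-submodule at a SUPERSINGULAR prime» is their Thm. 4.5 (Matsuno 2003 Prop. 4.1 / Hachimori–Matsuno 2000: Cassels–Tate on the layers +
bounded `ℤ_p`-coranks of `Sel(E/ℚ_n)` + `E(ℚ)[p] = 0`).  ALL the pure algebra of this road is in the tree (cell `bsd-potss`:
`Rank1Residual.Iwasawa.forall_finite_eq_bot_of_surjective_of_ker_eq_range[_of_injective]`, x1b GEN 44:
`IwasawaAlgebra.forall_finite_eq_bot_quotient_range_pi`), as is the canonical surjection `X ↠ X♭` for every key
(`SharpFlatSelmerDualData.exists_linearMap_ofSelmerDual`) and the existence / finite generation of the classical dual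
(`WeierstrassCurve.selmerDualData`, `SelmerDualData.module_finite_holds`).  Over `ℚ` there is ONE place of `ℚ_∞` above `2` and
`[ℚ₂ : ℚ₂] = 1`, so `r = 1`: the kernel of `X ↠ X♭` must be CYCLIC.

## What is proved (binder block of `OddBlindPackage.FlatNoFiniteSubmoduleAtTwo` VERBATIM; the displayed inputs quantify over every
## classical dual datum `S : W.SelmerDualData κ γ` in the SAME key `γ`)

* `flatNoFiniteSubmoduleAtTwo_of_classical_of_kernelFree (hA) (hC)` — NF♭ ⟸ (hA) «classical NF at supersingular `2`»: for `E/ℚ` good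
  supersingular at `2` and the cyclotomic data, EVERY classical dual Selmer datum `X = S.X` (f.g.) has no non-zero finite `Λ`-submodule
  ∧ (hC) «free kernel»: for every ♭ datum `D` (f.g., torsion) and every `Λ`-linear `π : S.X → D.X` over the inclusion `Sel♭ ≤ Sel`
  (pinning identity `D.toDual (π x) s = S.toDual x s`), `ker π = ι(Λ¹)` for an INJECTIVE `Λ`-linear `ι : Λ¹ → S.X`.  (Torsion of `X♭` unused.)
* ★★ `flatNoFiniteSubmoduleAtTwo_of_classical (hA) (hB) (hC)` — NF♭ ⟸ (hA) ∧ (hB) «`rank_Λ X(E/ℚ_∞) ≥ 1` at supersingular `2`»: some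
  `y ∈ S.X` with `f • y = 0 → f = 0` (Greenberg Thm. 1.7 shape) ∧ (hC) «CYCLIC kernel»: `ker π = Λ ∙ x₀` for some `x₀ ∈ S.X` (the image of
  a generator of `Ker Col♭` under Kobayashi's (7.18)_∞ arrow `H¹_Iw(T) → X`; Kitajima–Otsuki (4.2) + Prop. 3.32 at `p = 2`).  Here the
  torsion binder of NF♭ IS used (Prop. 4.6: the cyclic kernel is then free).

So slot 4 of the line = (hA) [classical, Hachimori–Matsuno at `p = 2`; print modulo «bounded coranks of `Sel(E/ℚ_n)`» (Kato–Rohrlich) and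
the Cassels–Tate layer pairing `HachimoriMatsuno2000.casselsTate_layerPairing`] + (hB) [Greenberg Thm. 1.7 at supersingular `2`] + (hC)
[the `p = 2` Poitou–Tate functional model `ker(X ↠ X♭) = toX(Ker Col♭)` (tree fact `thm714seq_sharpFlat_poitouTate_functionalModel_pinned`
carries `p ≠ 2`) + «`Ker Col♭` is a cyclic `Λ`-module at `2`» (Honda theory at `2`)].  None of the three is asserted here.

References: [KitajimaOtsuki2018] Prop. 3.32, Prop. 4.1, Thm. 4.5, Prop. 4.6, Prop. 4.7, Thm. 4.8 (arXiv:1607.03612 pp. 16–19);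
[GreenbergLNM1716] Thm. 1.7, pp. 104–105; [HachimoriMatsuno2000] Theorem (p. 2540); [BDKim2013] Thm. 1.1 / 3.14 (odd p; the other road);
[Sprung2012] Def. 7.9 / 7.11, Thm. 7.14 (3); [Kobayashi2003] (7.18)–(7.21).
-/

set_option autoImplicit false
-- the Theorems namespace of this sub repeats the summit name by design (D-0017 nested layout)
set_option linter.dupNamespace false

noncomputable section

open scoped Classical NumberField
open NumberField IsDedekindDomain WeierstrassCurve Literature.NumberTheory.EllipticCurves
  Literature.NumberTheory.EllipticCurves.Sprung2017 Literature.NumberTheory.EllipticCurves.Sprung2012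
  Literature.NumberTheory.EllipticCurves.Rank1Residual Literature.NumberTheory.EllipticCurves.Rank1Residual.Typed
  Literature.NumberTheory.EllipticCurves.Kobayashi2003 Literature.NumberTheory.EllipticCurves.IwasawaDual
  Literature.NumberTheory.GaloisRepresentations
  ZpExtension Summit.BirchSwinnertonDyer.Rank1Residual Summit.BirchSwinnertonDyer.Rank1Residual.Supersingular

namespace Summit.BirchSwinnertonDyer.BirchSwinnertonDyer.Theorems

namespace OddBlindNF

/-! ### §1 Two pieces of `Λ`-linear plumbing in rank one -/

/-- The `Λ`-linear map `Λ¹ → X`, `a ↦ a 0 • x₀` (the rank-one instance of the `ι : Λ^r → X` of Kitajima–Otsuki Prop. 4.6 / 4.7).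
Its range is the cyclic submodule `Λ ∙ x₀`. [cite: KitajimaOtsuki2018, Prop. 4.6 (arXiv:1607.03612 p. 19)] -/
theorem range_toSpanSingleton_comp_proj {X : Type} [AddCommGroup X] [Module (IwasawaAlgebra 2) X] (x₀ : X) :
    LinearMap.range ((LinearMap.toSpanSingleton (IwasawaAlgebra 2) X x₀).comp
      (LinearMap.proj (0 : Fin 1) : (Fin 1 → IwasawaAlgebra 2) →ₗ[IwasawaAlgebra 2] IwasawaAlgebra 2)) =
      Submodule.span (IwasawaAlgebra 2) {x₀} := by
  rw [LinearMap.range_comp_of_range_eq_top, LinearMap.range_toSpanSingleton]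
  rw [LinearMap.range_eq_top]
  intro a
  exact ⟨fun _ ↦ a, rfl⟩

/-- For a NON-TORSION element `y` (`f • y = 0 → f = 0`) the map `Λ¹ → X`, `a ↦ a 0 • y` is injective (an injective `Λ¹ ↪ X`, i.e.
`rank_Λ X ≥ 1` in the shape `Rank1Residual.Iwasawa.le_rank_of_injective` consumes). [cite: GreenbergLNM1716, Thm. 1.7 (shape)] -/
theorem injective_toSpanSingleton_comp_proj {X : Type} [AddCommGroup X] [Module (IwasawaAlgebra 2) X] {y : X}
    (hy : ∀ f : IwasawaAlgebra 2, f • y = 0 → f = 0) :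
    Function.Injective ((LinearMap.toSpanSingleton (IwasawaAlgebra 2) X y).comp
      (LinearMap.proj (0 : Fin 1) : (Fin 1 → IwasawaAlgebra 2) →ₗ[IwasawaAlgebra 2] IwasawaAlgebra 2)) := by
  rw [← LinearMap.ker_eq_bot, Submodule.eq_bot_iff]
  intro a ha
  rw [LinearMap.mem_ker, LinearMap.comp_apply, LinearMap.toSpanSingleton_apply] at ha
  have h0 : a 0 = 0 := hy _ ha
  funext i
  rw [Fin.fin_one_eq_zero i, h0, Pi.zero_apply]

/-! ### §2 NF♭ from classical NF + a FREE kernel (Kitajima–Otsuki Prop. 4.7 alone; torsion of `X♭` unused) -/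

/-- **NF♭ ⟸ classical NF at supersingular `2` + «`ker(X ↠ X♭)` is free of rank one».**  Conclusion = the body of
`OddBlindPackage.FlatNoFiniteSubmoduleAtTwo` (registry v2.11 :502–523) VERBATIM.  Proof: take the classical dual `S = W.selmerDualData κ hγ`
(finitely generated, `module_finite_holds`), the canonical surjection `π : S.X ↠ D.X` over `Sel♭ ≤ Sel`
(`SharpFlatSelmerDualData.exists_linearMap_ofSelmerDual`), the displayed injective `ι : Λ¹ ↪ S.X` with `ker π = range ι`, and Greenberg's
lemma in the tree's transport form `Rank1Residual.Iwasawa.forall_finite_eq_bot_of_surjective_of_ker_eq_range`.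
[cite: KitajimaOtsuki2018, Prop. 4.7 and Thm. 4.8 (arXiv:1607.03612 p. 19)] [cite: GreenbergLNM1716, pp. 104–105] -/
theorem flatNoFiniteSubmoduleAtTwo_of_classical_of_kernelFree
    (hA : ∀ (W : WeierstrassCurve ℚ) [W.IsElliptic] [W.IsGloballyMinimal], GoodSS W 2 →
      ∀ (κ : ZpExtension ℚ 2) (γ : Field.absoluteGaloisGroup ℚ),
        κ.IsCyclotomic → κ.IsTopGenerator γ → IsCyclotomicVariable 2 γ →
      ∀ (S : W.SelmerDualData κ γ) [Module.Finite (IwasawaAlgebra 2) S.X],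
        ∀ N : Submodule (IwasawaAlgebra 2) S.X, Finite N → N = ⊥)
    (hC : ∀ (W : WeierstrassCurve ℚ) [W.IsElliptic] [W.IsGloballyMinimal], GoodSS W 2 →
      ∀ (κ : ZpExtension ℚ 2) (γ : Field.absoluteGaloisGroup ℚ),
        κ.IsCyclotomic → κ.IsTopGenerator γ → IsCyclotomicVariable 2 γ →
      ∀ (v : HeightOneSpectrum (𝓞 ℚ)), (2 : 𝓞 ℚ) ∈ v.asIdeal →
      ∀ (g : Field.absoluteGaloisGroup (v.adicCompletion ℚ)) (c : ℕ → localPoints W (v.adicCompletion ℚ)),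
        κ.IsTopGenerator (resGalOfEmb (closureEmb (K := ℚ) (v.adicCompletion ℚ)) g) →
        (∀ n, c n ∈ localLayerPointsOfEmb κ (closureEmb (K := ℚ) (v.adicCompletion ℚ)) W n) →
        (∀ n, 1 ≤ n → localTraceOfEmb κ (closureEmb (K := ℚ) (v.adicCompletion ℚ)) W n (n + 1)
          (c (n + 1)) = W.frobeniusTrace 2 • c n - c (n - 1)) →
        (∀ z₀ : localLayerPointsOfEmb κ (closureEmb (K := ℚ) (v.adicCompletion ℚ)) W 0 →+ ℤ_[2],
          evalOn W (localLayerPointsOfEmb κ (closureEmb (K := ℚ) (v.adicCompletion ℚ)) W 0) z₀ (c 0) = 0 →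
            z₀ = 0) →
        (∀ a : ℤ_[2],
          (∃ z₀ : localLayerPointsOfEmb κ (closureEmb (K := ℚ) (v.adicCompletion ℚ)) W 0 →+ ℤ_[2],
            evalOn W (localLayerPointsOfEmb κ (closureEmb (K := ℚ) (v.adicCompletion ℚ)) W 0) z₀ (c 0) = 2 * a) →
          ∃ y : localLayerPointsOfEmb κ (closureEmb (K := ℚ) (v.adicCompletion ℚ)) W 0 →+ ℤ_[2],
            evalOn W (localLayerPointsOfEmb κ (closureEmb (K := ℚ) (v.adicCompletion ℚ)) W 0) y (c 0) = a) →
      ∀ (D : SharpFlatSelmerDualData W κ γ (closureEmb (K := ℚ) (v.adicCompletion ℚ))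
          (W.frobeniusTrace 2) g c .flat) [Module.Finite (IwasawaAlgebra 2) D.X],
        Module.IsTorsion (IwasawaAlgebra 2) D.X →
      ∀ (S : W.SelmerDualData κ γ) [Module.Finite (IwasawaAlgebra 2) S.X]
        (π : S.X →ₗ[IwasawaAlgebra 2] D.X),
        (∀ (x : S.X) (s : sharpFlatSelmerInfty W κ (closureEmb (K := ℚ) (v.adicCompletion ℚ)) (W.frobeniusTrace 2) g c .flat),
          D.toDual (π x) s = S.toDual x (AddSubgroup.inclusion
            (sharpFlatSelmerInfty_le_selmerInfty W κ (closureEmb (K := ℚ) (v.adicCompletion ℚ)) (W.frobeniusTrace 2) g c .flat) s)) →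
        ∃ ι : (Fin 1 → IwasawaAlgebra 2) →ₗ[IwasawaAlgebra 2] S.X,
          Function.Injective ι ∧ LinearMap.ker π = LinearMap.range ι) :
    ∀ (W : WeierstrassCurve ℚ) [W.IsElliptic] [W.IsGloballyMinimal], GoodSS W 2 →
    ∀ (κ : ZpExtension ℚ 2) (γ : Field.absoluteGaloisGroup ℚ),
      κ.IsCyclotomic → κ.IsTopGenerator γ → IsCyclotomicVariable 2 γ →
    ∀ (v : HeightOneSpectrum (𝓞 ℚ)), (2 : 𝓞 ℚ) ∈ v.asIdeal →
    ∀ (g : Field.absoluteGaloisGroup (v.adicCompletion ℚ)) (c : ℕ → localPoints W (v.adicCompletion ℚ)),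
      κ.IsTopGenerator (resGalOfEmb (closureEmb (K := ℚ) (v.adicCompletion ℚ)) g) →
      (∀ n, c n ∈ localLayerPointsOfEmb κ (closureEmb (K := ℚ) (v.adicCompletion ℚ)) W n) →
      (∀ n, 1 ≤ n → localTraceOfEmb κ (closureEmb (K := ℚ) (v.adicCompletion ℚ)) W n (n + 1)
        (c (n + 1)) = W.frobeniusTrace 2 • c n - c (n - 1)) →
      (∀ z₀ : localLayerPointsOfEmb κ (closureEmb (K := ℚ) (v.adicCompletion ℚ)) W 0 →+ ℤ_[2],
        evalOn W (localLayerPointsOfEmb κ (closureEmb (K := ℚ) (v.adicCompletion ℚ)) W 0) z₀ (c 0) = 0 →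
          z₀ = 0) →
      (∀ a : ℤ_[2],
        (∃ z₀ : localLayerPointsOfEmb κ (closureEmb (K := ℚ) (v.adicCompletion ℚ)) W 0 →+ ℤ_[2],
          evalOn W (localLayerPointsOfEmb κ (closureEmb (K := ℚ) (v.adicCompletion ℚ)) W 0) z₀ (c 0) = 2 * a) →
        ∃ y : localLayerPointsOfEmb κ (closureEmb (K := ℚ) (v.adicCompletion ℚ)) W 0 →+ ℤ_[2],
          evalOn W (localLayerPointsOfEmb κ (closureEmb (K := ℚ) (v.adicCompletion ℚ)) W 0) y (c 0) = a) →
    ∀ (D : SharpFlatSelmerDualData W κ γ (closureEmb (K := ℚ) (v.adicCompletion ℚ))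
        (W.frobeniusTrace 2) g c .flat) [Module.Finite (IwasawaAlgebra 2) D.X],
      Module.IsTorsion (IwasawaAlgebra 2) D.X →
      ∀ N : Submodule (IwasawaAlgebra 2) D.X, Finite N → N = ⊥ := by
  intro W _ _ hss κ γ hκ hγ hcyc v hv g c hg hc htr hz hsat D _ htors
  -- the classical dual `X(E/ℚ_∞)` in the same key `γ`, finitely generated
  let S : W.SelmerDualData κ γ := W.selmerDualData κ hγ
  haveI : Module.Finite (IwasawaAlgebra 2) S.X := S.module_finite_holds hγ
  -- the canonical surjection `X ↠ X♭` over `Sel♭ ≤ Sel`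
  obtain ⟨π, hπ, hpin⟩ := SharpFlatSelmerDualData.exists_linearMap_ofSelmerDual (W := W) (κ := κ)
    (ι := closureEmb (K := ℚ) (v.adicCompletion ℚ)) (ap := W.frobeniusTrace 2) (g := g) (c := c) (col := .flat) S D
  -- the displayed free kernel
  obtain ⟨ι, hι, hker⟩ := hC W hss κ γ hκ hγ hcyc v hv g c hg hc htr hz hsat D htors S π hpin
  -- Greenberg's lemma, transported along `X ⧸ ι(Λ¹) ≃ X♭`
  exact Rank1Residual.Iwasawa.forall_finite_eq_bot_of_surjective_of_ker_eq_range 2 (hA W hss κ γ hκ hγ hcyc S) ι hι π hπ hker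

/-! ### §3 ★★ NF♭ from classical NF + rank `≥ 1` + a CYCLIC kernel (Kitajima–Otsuki Prop. 4.6 + 4.7 = Thm. 4.8 shape, `r = 1`) -/

/-- ★★ **NF♭ ⟸ (hA) classical NF at supersingular `2` + (hB) `rank_Λ X(E/ℚ_∞) ≥ 1` + (hC) «`ker(X ↠ X♭)` is CYCLIC».**  Conclusion = the
body of `OddBlindPackage.FlatNoFiniteSubmoduleAtTwo` (registry v2.11 :502–523) VERBATIM.  (hB): some `y ∈ X` with `f • y = 0 → f = 0`
(Greenberg Thm. 1.7 at a supersingular prime: `Sel_{p^∞}(E/ℚ_∞)` is not `Λ`-cotorsion).  (hC): for every `Λ`-linear `π : X → X♭` over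
`Sel♭ ≤ Sel`, `ker π = Λ ∙ x₀` for some `x₀` (Kitajima–Otsuki (4.2) + Prop. 3.32 for `♭` at `2`: the annihilator of `Sel♭_∞` in `X` is the
image of `Ker Col♭ ≅ Λ` under Kobayashi's arrow `H¹_Iw(T) → X`).  Proof: `ι : Λ¹ → X`, `a ↦ a 0 • x₀` has range `ker π`; `j : a ↦ a 0 • y`
is injective; `X♭ = D.X` is torsion (the binder); apply `Rank1Residual.Iwasawa.forall_finite_eq_bot_of_surjective_of_ker_eq_range_of_injective`
(Prop. 4.6 makes `ι` injective, Prop. 4.7 transports).  The three inputs are displayed, not proved.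
[cite: KitajimaOtsuki2018, Prop. 4.6, Prop. 4.7, Thm. 4.8 (arXiv:1607.03612 p. 19)] [cite: GreenbergLNM1716, Thm. 1.7 and pp. 104–105] -/
theorem flatNoFiniteSubmoduleAtTwo_of_classical
    (hA : ∀ (W : WeierstrassCurve ℚ) [W.IsElliptic] [W.IsGloballyMinimal], GoodSS W 2 →
      ∀ (κ : ZpExtension ℚ 2) (γ : Field.absoluteGaloisGroup ℚ),
        κ.IsCyclotomic → κ.IsTopGenerator γ → IsCyclotomicVariable 2 γ →
      ∀ (S : W.SelmerDualData κ γ) [Module.Finite (IwasawaAlgebra 2) S.X],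
        ∀ N : Submodule (IwasawaAlgebra 2) S.X, Finite N → N = ⊥)
    (hB : ∀ (W : WeierstrassCurve ℚ) [W.IsElliptic] [W.IsGloballyMinimal], GoodSS W 2 →
      ∀ (κ : ZpExtension ℚ 2) (γ : Field.absoluteGaloisGroup ℚ),
        κ.IsCyclotomic → κ.IsTopGenerator γ → IsCyclotomicVariable 2 γ →
      ∀ (S : W.SelmerDualData κ γ) [Module.Finite (IwasawaAlgebra 2) S.X],
        ∃ y : S.X, ∀ f : IwasawaAlgebra 2, f • y = 0 → f = 0)
    (hC : ∀ (W : WeierstrassCurve ℚ) [W.IsElliptic] [W.IsGloballyMinimal], GoodSS W 2 →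
      ∀ (κ : ZpExtension ℚ 2) (γ : Field.absoluteGaloisGroup ℚ),
        κ.IsCyclotomic → κ.IsTopGenerator γ → IsCyclotomicVariable 2 γ →
      ∀ (v : HeightOneSpectrum (𝓞 ℚ)), (2 : 𝓞 ℚ) ∈ v.asIdeal →
      ∀ (g : Field.absoluteGaloisGroup (v.adicCompletion ℚ)) (c : ℕ → localPoints W (v.adicCompletion ℚ)),
        κ.IsTopGenerator (resGalOfEmb (closureEmb (K := ℚ) (v.adicCompletion ℚ)) g) →
        (∀ n, c n ∈ localLayerPointsOfEmb κ (closureEmb (K := ℚ) (v.adicCompletion ℚ)) W n) →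
        (∀ n, 1 ≤ n → localTraceOfEmb κ (closureEmb (K := ℚ) (v.adicCompletion ℚ)) W n (n + 1)
          (c (n + 1)) = W.frobeniusTrace 2 • c n - c (n - 1)) →
        (∀ z₀ : localLayerPointsOfEmb κ (closureEmb (K := ℚ) (v.adicCompletion ℚ)) W 0 →+ ℤ_[2],
          evalOn W (localLayerPointsOfEmb κ (closureEmb (K := ℚ) (v.adicCompletion ℚ)) W 0) z₀ (c 0) = 0 →
            z₀ = 0) →
        (∀ a : ℤ_[2],
          (∃ z₀ : localLayerPointsOfEmb κ (closureEmb (K := ℚ) (v.adicCompletion ℚ)) W 0 →+ ℤ_[2],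
            evalOn W (localLayerPointsOfEmb κ (closureEmb (K := ℚ) (v.adicCompletion ℚ)) W 0) z₀ (c 0) = 2 * a) →
          ∃ y : localLayerPointsOfEmb κ (closureEmb (K := ℚ) (v.adicCompletion ℚ)) W 0 →+ ℤ_[2],
            evalOn W (localLayerPointsOfEmb κ (closureEmb (K := ℚ) (v.adicCompletion ℚ)) W 0) y (c 0) = a) →
      ∀ (D : SharpFlatSelmerDualData W κ γ (closureEmb (K := ℚ) (v.adicCompletion ℚ))
          (W.frobeniusTrace 2) g c .flat) [Module.Finite (IwasawaAlgebra 2) D.X],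
        Module.IsTorsion (IwasawaAlgebra 2) D.X →
      ∀ (S : W.SelmerDualData κ γ) [Module.Finite (IwasawaAlgebra 2) S.X]
        (π : S.X →ₗ[IwasawaAlgebra 2] D.X),
        (∀ (x : S.X) (s : sharpFlatSelmerInfty W κ (closureEmb (K := ℚ) (v.adicCompletion ℚ)) (W.frobeniusTrace 2) g c .flat),
          D.toDual (π x) s = S.toDual x (AddSubgroup.inclusion
            (sharpFlatSelmerInfty_le_selmerInfty W κ (closureEmb (K := ℚ) (v.adicCompletion ℚ)) (W.frobeniusTrace 2) g c .flat) s)) →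
        ∃ x₀ : S.X, LinearMap.ker π = Submodule.span (IwasawaAlgebra 2) {x₀}) :
    ∀ (W : WeierstrassCurve ℚ) [W.IsElliptic] [W.IsGloballyMinimal], GoodSS W 2 →
    ∀ (κ : ZpExtension ℚ 2) (γ : Field.absoluteGaloisGroup ℚ),
      κ.IsCyclotomic → κ.IsTopGenerator γ → IsCyclotomicVariable 2 γ →
    ∀ (v : HeightOneSpectrum (𝓞 ℚ)), (2 : 𝓞 ℚ) ∈ v.asIdeal →
    ∀ (g : Field.absoluteGaloisGroup (v.adicCompletion ℚ)) (c : ℕ → localPoints W (v.adicCompletion ℚ)),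
      κ.IsTopGenerator (resGalOfEmb (closureEmb (K := ℚ) (v.adicCompletion ℚ)) g) →
      (∀ n, c n ∈ localLayerPointsOfEmb κ (closureEmb (K := ℚ) (v.adicCompletion ℚ)) W n) →
      (∀ n, 1 ≤ n → localTraceOfEmb κ (closureEmb (K := ℚ) (v.adicCompletion ℚ)) W n (n + 1)
        (c (n + 1)) = W.frobeniusTrace 2 • c n - c (n - 1)) →
      (∀ z₀ : localLayerPointsOfEmb κ (closureEmb (K := ℚ) (v.adicCompletion ℚ)) W 0 →+ ℤ_[2],
        evalOn W (localLayerPointsOfEmb κ (closureEmb (K := ℚ) (v.adicCompletion ℚ)) W 0) z₀ (c 0) = 0 →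
          z₀ = 0) →
      (∀ a : ℤ_[2],
        (∃ z₀ : localLayerPointsOfEmb κ (closureEmb (K := ℚ) (v.adicCompletion ℚ)) W 0 →+ ℤ_[2],
          evalOn W (localLayerPointsOfEmb κ (closureEmb (K := ℚ) (v.adicCompletion ℚ)) W 0) z₀ (c 0) = 2 * a) →
        ∃ y : localLayerPointsOfEmb κ (closureEmb (K := ℚ) (v.adicCompletion ℚ)) W 0 →+ ℤ_[2],
          evalOn W (localLayerPointsOfEmb κ (closureEmb (K := ℚ) (v.adicCompletion ℚ)) W 0) y (c 0) = a) →
    ∀ (D : SharpFlatSelmerDualData W κ γ (closureEmb (K := ℚ) (v.adicCompletion ℚ))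
        (W.frobeniusTrace 2) g c .flat) [Module.Finite (IwasawaAlgebra 2) D.X],
      Module.IsTorsion (IwasawaAlgebra 2) D.X →
      ∀ N : Submodule (IwasawaAlgebra 2) D.X, Finite N → N = ⊥ := by
  intro W _ _ hss κ γ hκ hγ hcyc v hv g c hg hc htr hz hsat D _ htors
  -- the classical dual `X(E/ℚ_∞)` in the same key `γ`, finitely generated
  let S : W.SelmerDualData κ γ := W.selmerDualData κ hγ
  haveI : Module.Finite (IwasawaAlgebra 2) S.X := S.module_finite_holds hγ
  -- the canonical surjection `X ↠ X♭` over `Sel♭ ≤ Sel`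
  obtain ⟨π, hπ, hpin⟩ := SharpFlatSelmerDualData.exists_linearMap_ofSelmerDual (W := W) (κ := κ)
    (ι := closureEmb (K := ℚ) (v.adicCompletion ℚ)) (ap := W.frobeniusTrace 2) (g := g) (c := c) (col := .flat) S D
  -- (hC) a cyclic kernel `ker π = Λ ∙ x₀`, as the range of `ι : a ↦ a 0 • x₀`
  obtain ⟨x₀, hx₀⟩ := hC W hss κ γ hκ hγ hcyc v hv g c hg hc htr hz hsat D htors S π hpin
  have hker : LinearMap.ker π = LinearMap.range ((LinearMap.toSpanSingleton (IwasawaAlgebra 2) S.X x₀).comp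
      (LinearMap.proj (0 : Fin 1) : (Fin 1 → IwasawaAlgebra 2) →ₗ[IwasawaAlgebra 2] IwasawaAlgebra 2)) := by
    rw [range_toSpanSingleton_comp_proj, hx₀]
  -- (hB) a non-torsion element `y`, as an injective `j : a ↦ a 0 • y`
  obtain ⟨y, hy⟩ := hB W hss κ γ hκ hγ hcyc S
  -- Kitajima–Otsuki Prop. 4.6 + 4.7 in rank one
  exact Rank1Residual.Iwasawa.forall_finite_eq_bot_of_surjective_of_ker_eq_range_of_injective 2 (hA W hss κ γ hκ hγ hcyc S)
    _ (injective_toSpanSingleton_comp_proj hy) _ π hπ hker htors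

end OddBlindNF

end Summit.BirchSwinnertonDyer.BirchSwinnertonDyer.Theorems

end
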